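import Summits.Ventures.GridStability.Models.InverterPLLRecast

/-!
# GridStability/Models/InverterPLLDivergence — the two DIVERGING regimes of the PLL generalized swing equation, certified: explicit pieces of the basins of `ω = +∞` / `ω = −∞` and an outer strip for every bounded motion (rung G3.d, honest-framing companion)

Cell `gridfusion` (LADDER-GRIDFUSION, apex-line rung G3.d «PLL-swing», `plan/PARTITION.md` A21;
seat gridfusion-model-3 (g7), models/MODEL-3-NOTES.md §1 (P6)).

THE PRINTED PICTURE. For the generalized swing equation of a PLL-synchronised converter
`θ̇ = ω`, `ω̇ = I − sin θ − (α cos θ − D) ω` [cite: DuEtAl2024, §II Eq. (1)] (after [cite: MaEtAl2022])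
the print treats «`ω = ±∞` as two different attractors» and plots BY MODEL SIMULATION (RK4) «the
attracting basins of the three asymptotic states (`ω = 0`, `∞`, and `−∞`)» at
`(I, D, α) = (0.4, 0.39, 0.7)` [cite: DuEtAl2024, §II, Fig. 1(a)–(b)] («stable if `ω` is damped to 0
…, unstable if `ω` is diverging with time»). The G3.d row of record certifies an INNER piece of the
first basin (`GenSwing.duI04.deg4_A_k32_wide_basin`, `Models/InverterPLLDuI04Roa.lean`).

WHAT THIS FILE CERTIFIES (kernel, certificate-free; every parameter triple with `D > 0`, `α ≥ 0`).
With the «wind-up» variable `u := ω + α sin θ`, along every classical solution `u̇ = I − sin θ + D ω`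
EXACTLY (`hasDerivAt_windup`) `= D (u − u⁺) + (1 + D α)(1 − sin θ) = D (u + u⁻) − (1 + D α)(1 + sin θ)`
with `u⁺ := α + (1 − I)/D`, `u⁻ := α + (1 + I)/D`; hence `(u − u⁺) e^{−Dt}` is non-decreasing and
`(u + u⁻) e^{−Dt}` non-increasing along EVERY solution (`monotone_windup_up`, `antitone_windup_down`;
an elementary Grönwall comparison — no Lyapunov function, no SOS). Consequences:
* `tendsto_freq_atTop_of_windup_gt`: `ω + α sin θ > u⁺` at one instant ⇒ `ω(t) → +∞` (rate `D`) and
  `θ(t) → +∞` — a certified piece of the basin of «`ω = +∞`»; `tendsto_freq_atBot_of_windup_lt`: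
  `ω + α sin θ < −u⁻` at one instant ⇒ `ω(t) → −∞`, `θ(t) → −∞`;
* `windup_mem_Icc_of_tendsto`: every solution whose frequency mismatch has a finite limit — in
  particular every motion attracted by the operating point — satisfies `−u⁻ ≤ ω(t) + α sin θ(t) ≤ u⁺`
  AT ALL TIMES: a certified OUTER strip containing the whole attracting basin of the operational state
  (the G3.d certificate is the INNER estimate; the true basin is sandwiched, kernel on both sides).
§2 reads these on the instance of record «PLLSWING-Du-I04» (`GenSwing.duI04`, `I′ = 63365/158413`,
A1″): `u⁺ = 138294749/61781070 ≈ 2.2385`, `u⁻ = 265024749/61781070 ≈ 4.2897`; rounded sentences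
`ω₀ + 0.7 sin θ₀ ≥ 56/25 ⇒ ω → +∞`, `ω₀ + 0.7 sin θ₀ ≤ −43/10 ⇒ ω → −∞`, basin of the operating
point `⊆ {−43/10 ≤ ω + 0.7 sin θ ≤ 56/25}`.

THREE COLUMNS. CERTIFIED: the theorems below (std axioms). MODELLED: every sentence is about the
printed dimensionless model Eq. (1) — MODEL-VALIDITY MV-6P(GenSwing) + MV-P(`I′ = s*`): PLL amplitude
normalisation, frequency/integrator LIMITERS and anti-windup, current-controller / filter / line
cascade, LVRT logic ABSENT; in a device the integrator limiter is exactly what interrupts the divergence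
certified here for the MODEL — the theorems say where the reduced model leaves its own domain of
adequacy, nothing about a converter or a grid. VALIDATED (juxtaposed, never merged): the simulated
basins of [cite: DuEtAl2024, Fig. 1(b)] (`D = 0.39`) and Fig. 5(a) (`D = 0.06`). Presearch (model-3 g7):
the divergence is printed as a simulation finding (ibid.); the constant-damping PLL/pendulum literature
has a bounded cylinder portrait instead ([cite: AndronovVittKhaikin1966, Ch. VII §3]; Kudrewicz–Wąsowicz
2007 Ch. 3); no printed closed-form divergence threshold for Eq. (1) located (corpus hybrid + galaxy);
the comparison argument is ours [folklore technique: Grönwall].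
-/

noncomputable section

open Real Set Filter Topology

namespace Summit.Ventures.GridStability.Models.InverterPLL.GenSwing

variable (G : GenSwing)

/-! ## §1 The wind-up variable and the two monotone quantities (every `GenSwing`, `D > 0`, `α ≥ 0`) -/

/-- The wind-up variable `u = ω + α sin θ` of the generalized swing equation
[cite: DuEtAl2024, Eq. (1)]: the combination whose time derivative loses the state-dependent damping
term (`u̇ = I − sin θ + D ω`, `hasDerivAt_windup`). -/
def windup (θ ω : ℝ) : ℝ := ω + G.α * sin θ

/-- Upper divergence threshold `u⁺ = α + (1 − I)/D`: `ω + α sin θ > u⁺` at one instant forces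
`ω → +∞` (`tendsto_freq_atTop_of_windup_gt`). -/
def divergeUp : ℝ := G.α + (1 - G.I) / G.D

/-- Lower divergence threshold `u⁻ = α + (1 + I)/D`: `ω + α sin θ < −u⁻` at one instant forces
`ω → −∞` (`tendsto_freq_atBot_of_windup_lt`). -/
def divergeDown : ℝ := G.α + (1 + G.I) / G.D

variable {G}

/-- Along every classical solution of Eq. (1), `d/dt (ω + α sin θ) = I − sin θ + D ω` — the
`α cos θ · ω` terms cancel exactly. -/
theorem hasDerivAt_windup {θ ω : ℝ → ℝ} (h : G.IsSolution θ ω) (t : ℝ) :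
    HasDerivAt (fun τ => G.windup (θ τ) (ω τ)) (G.I - sin (θ t) + G.D * ω t) t := by
  have hθ := h.angle t
  have hω := h.freq t
  have hs : HasDerivAt (fun τ => G.α * sin (θ τ)) (G.α * (cos (θ t) * ω t)) t := by
    simpa [dθ] using hθ.sin.const_mul G.α
  have hsum := hω.add hs
  have he : G.dω (θ t) (ω t) + G.α * (cos (θ t) * ω t) = G.I - sin (θ t) + G.D * ω t := by
    simp only [dω]; ring
  rw [he] at hsum
  have hfun : (fun τ => G.windup (θ τ) (ω τ)) = fun τ => ω τ + G.α * sin (θ τ) := rfl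
  rw [hfun]
  exact hsum

/-- The derivative of the wind-up variable in «upper» form:
`I − sin θ + D ω = D (u − u⁺) + (1 + D α)(1 − sin θ)`. -/
theorem windup_deriv_eq_up (hD : G.D ≠ 0) (θ ω : ℝ) :
    G.I - sin θ + G.D * ω
      = G.D * (G.windup θ ω - G.divergeUp) + (1 + G.D * G.α) * (1 - sin θ) := by
  simp only [windup, divergeUp]
  field_simp
  ring

/-- The derivative of the wind-up variable in «lower» form:
`I − sin θ + D ω = D (u + u⁻) − (1 + D α)(1 + sin θ)`. -/
theorem windup_deriv_eq_down (hD : G.D ≠ 0) (θ ω : ℝ) :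
    G.I - sin θ + G.D * ω
      = G.D * (G.windup θ ω + G.divergeDown) - (1 + G.D * G.α) * (1 + sin θ) := by
  simp only [windup, divergeDown]
  field_simp
  ring

/-- **Monotone quantity (upper).** For `D > 0`, `α ≥ 0`, along every solution the function
`t ↦ (ω + α sin θ − u⁺) · e^{−D t}` is non-decreasing on the whole time axis. -/
theorem monotone_windup_up (hD : 0 < G.D) (hα : 0 ≤ G.α) {θ ω : ℝ → ℝ} (h : G.IsSolution θ ω) :
    Monotone (fun t => (G.windup (θ t) (ω t) - G.divergeUp) * exp (-(G.D * t))) := by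
  have hderiv : ∀ t, HasDerivAt (fun τ => (G.windup (θ τ) (ω τ) - G.divergeUp) * exp (-(G.D * τ)))
      ((1 + G.D * G.α) * (1 - sin (θ t)) * exp (-(G.D * t))) t := by
    intro t
    have h1 : HasDerivAt (fun τ => G.windup (θ τ) (ω τ) - G.divergeUp)
        (G.I - sin (θ t) + G.D * ω t) t := (hasDerivAt_windup h t).sub_const _
    have h2 : HasDerivAt (fun τ => exp (-(G.D * τ))) (exp (-(G.D * t)) * (-(G.D * 1))) t := by
      have hl : HasDerivAt (fun τ => -(G.D * τ)) (-(G.D * 1)) t :=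
        ((hasDerivAt_id' t).const_mul G.D).neg
      exact hl.exp
    have h12 := h1.mul h2
    have he : (G.I - sin (θ t) + G.D * ω t) * exp (-(G.D * t))
        + (G.windup (θ t) (ω t) - G.divergeUp) * (exp (-(G.D * t)) * (-(G.D * 1)))
        = (1 + G.D * G.α) * (1 - sin (θ t)) * exp (-(G.D * t)) := by
      rw [windup_deriv_eq_up hD.ne' (θ t) (ω t)]
      ring
    rw [he] at h12
    exact h12
  refine monotone_of_deriv_nonneg (fun t => (hderiv t).differentiableAt) fun t => ?_
  rw [(hderiv t).deriv]
  have h1 : 0 ≤ 1 + G.D * G.α := by have := mul_nonneg hD.le hα; linarith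
  have h2 : 0 ≤ 1 - sin (θ t) := by linarith [sin_le_one (θ t)]
  have h3 : 0 ≤ exp (-(G.D * t)) := (exp_pos _).le
  exact mul_nonneg (mul_nonneg h1 h2) h3

/-- **Monotone quantity (lower).** For `D > 0`, `α ≥ 0`, along every solution the function
`t ↦ (ω + α sin θ + u⁻) · e^{−D t}` is non-increasing on the whole time axis. -/
theorem antitone_windup_down (hD : 0 < G.D) (hα : 0 ≤ G.α) {θ ω : ℝ → ℝ} (h : G.IsSolution θ ω) :
    Antitone (fun t => (G.windup (θ t) (ω t) + G.divergeDown) * exp (-(G.D * t))) := by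
  have hderiv : ∀ t, HasDerivAt (fun τ => (G.windup (θ τ) (ω τ) + G.divergeDown) * exp (-(G.D * τ)))
      (-((1 + G.D * G.α) * (1 + sin (θ t)) * exp (-(G.D * t)))) t := by
    intro t
    have h1 : HasDerivAt (fun τ => G.windup (θ τ) (ω τ) + G.divergeDown)
        (G.I - sin (θ t) + G.D * ω t) t := (hasDerivAt_windup h t).add_const _
    have h2 : HasDerivAt (fun τ => exp (-(G.D * τ))) (exp (-(G.D * t)) * (-(G.D * 1))) t := by
      have hl : HasDerivAt (fun τ => -(G.D * τ)) (-(G.D * 1)) t :=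
        ((hasDerivAt_id' t).const_mul G.D).neg
      exact hl.exp
    have h12 := h1.mul h2
    have he : (G.I - sin (θ t) + G.D * ω t) * exp (-(G.D * t))
        + (G.windup (θ t) (ω t) + G.divergeDown) * (exp (-(G.D * t)) * (-(G.D * 1)))
        = -((1 + G.D * G.α) * (1 + sin (θ t)) * exp (-(G.D * t))) := by
      rw [windup_deriv_eq_down hD.ne' (θ t) (ω t)]
      ring
    rw [he] at h12
    exact h12
  refine antitone_of_deriv_nonpos (fun t => (hderiv t).differentiableAt) fun t => ?_
  rw [(hderiv t).deriv]
  have h1 : 0 ≤ 1 + G.D * G.α := by have := mul_nonneg hD.le hα; linarith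
  have h2 : 0 ≤ 1 + sin (θ t) := by linarith [neg_one_le_sin (θ t)]
  have h3 : 0 ≤ exp (-(G.D * t)) := (exp_pos _).le
  have : 0 ≤ (1 + G.D * G.α) * (1 + sin (θ t)) * exp (-(G.D * t)) :=
    mul_nonneg (mul_nonneg h1 h2) h3
  linarith

/-- Rescaling step shared by the two exponential bounds. -/
private theorem mul_exp_shift_le {a b D s t : ℝ}
    (h : a * exp (-(D * s)) ≤ b * exp (-(D * t))) : a * exp (D * (t - s)) ≤ b := by
  have key := mul_le_mul_of_nonneg_right h (exp_pos (D * t)).le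
  have harg : -(D * s) + D * t = D * (t - s) := by ring
  rw [mul_assoc, ← exp_add, harg, mul_assoc, ← exp_add] at key
  simpa using key

/-- Exponential lower bound: for `s ≤ t`, `(u(s) − u⁺) e^{D (t − s)} ≤ u(t) − u⁺`. -/
theorem windup_sub_divergeUp_ge (hD : 0 < G.D) (hα : 0 ≤ G.α) {θ ω : ℝ → ℝ}
    (h : G.IsSolution θ ω) {s t : ℝ} (hst : s ≤ t) :
    (G.windup (θ s) (ω s) - G.divergeUp) * exp (G.D * (t - s))
      ≤ G.windup (θ t) (ω t) - G.divergeUp :=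
  mul_exp_shift_le (monotone_windup_up hD hα h hst)

/-- Exponential upper bound: for `s ≤ t`, `u(t) + u⁻ ≤ (u(s) + u⁻) e^{D (t − s)}`. -/
theorem windup_add_divergeDown_le (hD : 0 < G.D) (hα : 0 ≤ G.α) {θ ω : ℝ → ℝ}
    (h : G.IsSolution θ ω) {s t : ℝ} (hst : s ≤ t) :
    G.windup (θ t) (ω t) + G.divergeDown
      ≤ (G.windup (θ s) (ω s) + G.divergeDown) * exp (G.D * (t - s)) := by
  have hm := antitone_windup_down hD hα h hst
  have key := mul_le_mul_of_nonneg_right hm (exp_pos (G.D * t)).le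
  have harg : -(G.D * s) + G.D * t = G.D * (t - s) := by ring
  simp only at key
  rw [mul_assoc, ← exp_add, mul_assoc, ← exp_add, harg] at key
  simpa using key

/-- **Divergence to `+∞` (a certified piece of the basin of the «attractor `ω = +∞`» of
[cite: DuEtAl2024, Fig. 1(b)]).** For `D > 0`, `α ≥ 0`: if at some instant `t₀` the wind-up variable
exceeds `u⁺ = α + (1 − I)/D`, i.e. `ω(t₀) + α sin θ(t₀) > u⁺`, then the frequency mismatch diverges,
`ω(t) → +∞` (indeed `ω(t) ≥ u⁺ − α + (u(t₀) − u⁺) e^{D (t − t₀)}` for `t ≥ t₀`). MODELLED: Eq. (1);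
no limiter (MV-6P). -/
theorem tendsto_freq_atTop_of_windup_gt (hD : 0 < G.D) (hα : 0 ≤ G.α) {θ ω : ℝ → ℝ}
    (h : G.IsSolution θ ω) {t₀ : ℝ} (h0 : G.divergeUp < G.windup (θ t₀) (ω t₀)) :
    Tendsto ω atTop atTop := by
  set c := G.windup (θ t₀) (ω t₀) - G.divergeUp with hc
  have hcpos : 0 < c := by rw [hc]; linarith
  -- the comparison function `K + c · e^{D (t − t₀)}` tends to `+∞`
  have hlin : Tendsto (fun t => G.D * (t - t₀)) atTop atTop :=
    Tendsto.const_mul_atTop hD (tendsto_atTop_add_const_right atTop (-t₀) tendsto_id)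
  have hexp : Tendsto (fun t => c * exp (G.D * (t - t₀))) atTop atTop :=
    (tendsto_exp_atTop.comp hlin).const_mul_atTop hcpos
  have hcmp : Tendsto (fun t => (G.divergeUp - G.α) + c * exp (G.D * (t - t₀))) atTop atTop :=
    tendsto_atTop_add_const_left atTop _ hexp
  refine tendsto_atTop_mono' atTop ?_ hcmp
  filter_upwards [eventually_ge_atTop t₀] with t ht
  have hw := windup_sub_divergeUp_ge hD hα h ht
  have hsin : G.α * sin (θ t) ≤ G.α := by
    have := sin_le_one (θ t)
    nlinarith
  have hu : G.windup (θ t) (ω t) = ω t + G.α * sin (θ t) := rfl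
  rw [← hc] at hw; linarith

/-- **Divergence to `−∞` (a certified piece of the basin of the «attractor `ω = −∞`»).** For
`D > 0`, `α ≥ 0`: if at some instant `ω(t₀) + α sin θ(t₀) < −u⁻`, `u⁻ = α + (1 + I)/D`, then
`ω(t) → −∞`. MODELLED: Eq. (1); no limiter (MV-6P). -/
theorem tendsto_freq_atBot_of_windup_lt (hD : 0 < G.D) (hα : 0 ≤ G.α) {θ ω : ℝ → ℝ}
    (h : G.IsSolution θ ω) {t₀ : ℝ} (h0 : G.windup (θ t₀) (ω t₀) < -G.divergeDown) :
    Tendsto ω atTop atBot := by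
  set c := G.windup (θ t₀) (ω t₀) + G.divergeDown with hc
  have hcneg : c < 0 := by rw [hc]; linarith
  have hlin : Tendsto (fun t => G.D * (t - t₀)) atTop atTop :=
    Tendsto.const_mul_atTop hD (tendsto_atTop_add_const_right atTop (-t₀) tendsto_id)
  have hexp : Tendsto (fun t => c * exp (G.D * (t - t₀))) atTop atBot :=
    (tendsto_exp_atTop.comp hlin).const_mul_atTop_of_neg hcneg
  have hcmp : Tendsto (fun t => (G.α - G.divergeDown) + c * exp (G.D * (t - t₀))) atTop atBot :=
    tendsto_atBot_add_const_left atTop _ hexp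
  refine tendsto_atBot_mono' atTop ?_ hcmp
  filter_upwards [eventually_ge_atTop t₀] with t ht
  have hw := windup_add_divergeDown_le hD hα h ht
  have hsin : -G.α ≤ G.α * sin (θ t) := by
    have := neg_one_le_sin (θ t)
    nlinarith
  have hu : G.windup (θ t) (ω t) = ω t + G.α * sin (θ t) := rfl
  rw [← hc] at hw; linarith

/-- Along a diverging motion the phase mismatch slips indefinitely: `ω → +∞ ⇒ θ → +∞`
(`θ̇ = ω ≥ 1` eventually, mean-value bound). -/
theorem tendsto_angle_atTop_of_tendsto_freq_atTop {θ ω : ℝ → ℝ} (h : G.IsSolution θ ω)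
    (hω : Tendsto ω atTop atTop) : Tendsto θ atTop atTop := by
  obtain ⟨t₁, ht₁⟩ := eventually_atTop.1 (hω.eventually_ge_atTop 1)
  have hdθ : ∀ x, HasDerivAt θ (ω x) x := fun x => by simpa [dθ] using h.angle x
  have hcont : ContinuousOn θ (Ici t₁) := fun x _ => (hdθ x).continuousAt.continuousWithinAt
  have hdiff : DifferentiableOn ℝ θ (interior (Ici t₁)) :=
    fun x _ => (hdθ x).differentiableAt.differentiableWithinAt
  have hge : ∀ x ∈ interior (Ici t₁), (1 : ℝ) ≤ deriv θ x := by
    intro x hx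
    rw [interior_Ici] at hx
    rw [(hdθ x).deriv]
    exact ht₁ x (le_of_lt hx)
  have key : ∀ t, t₁ ≤ t → 1 * (t - t₁) ≤ θ t - θ t₁ := fun t ht =>
    (convex_Ici t₁).mul_sub_le_image_sub_of_le_deriv hcont hdiff hge t₁ (mem_Ici.2 le_rfl) t
      (mem_Ici.2 ht) ht
  have hcmp : Tendsto (fun t => θ t₁ + 1 * (t - t₁)) atTop atTop :=
    tendsto_atTop_add_const_left _ _
      (Tendsto.const_mul_atTop one_pos (tendsto_atTop_add_const_right _ _ tendsto_id))
  refine tendsto_atTop_mono' atTop ?_ hcmp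
  filter_upwards [eventually_ge_atTop t₁] with t ht
  have := key t ht
  linarith

/-- Along a motion diverging downwards the phase mismatch slips indefinitely backwards:
`ω → −∞ ⇒ θ → −∞`. -/
theorem tendsto_angle_atBot_of_tendsto_freq_atBot {θ ω : ℝ → ℝ} (h : G.IsSolution θ ω)
    (hω : Tendsto ω atTop atBot) : Tendsto θ atTop atBot := by
  obtain ⟨t₁, ht₁⟩ := eventually_atTop.1 (hω.eventually_le_atBot (-1))
  have hdθ : ∀ x, HasDerivAt θ (ω x) x := fun x => by simpa [dθ] using h.angle x
  have hdn : ∀ x, HasDerivAt (fun τ => -θ τ) (-ω x) x := fun x => (hdθ x).neg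
  have hcont : ContinuousOn (fun τ => -θ τ) (Ici t₁) :=
    fun x _ => (hdn x).continuousAt.continuousWithinAt
  have hdiff : DifferentiableOn ℝ (fun τ => -θ τ) (interior (Ici t₁)) :=
    fun x _ => (hdn x).differentiableAt.differentiableWithinAt
  have hge : ∀ x ∈ interior (Ici t₁), (1 : ℝ) ≤ deriv (fun τ => -θ τ) x := by
    intro x hx
    rw [interior_Ici] at hx
    rw [(hdn x).deriv]
    have := ht₁ x (le_of_lt hx)
    linarith
  have key : ∀ t, t₁ ≤ t → 1 * (t - t₁) ≤ -θ t - -θ t₁ := fun t ht =>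
    (convex_Ici t₁).mul_sub_le_image_sub_of_le_deriv hcont hdiff hge t₁ (mem_Ici.2 le_rfl) t
      (mem_Ici.2 ht) ht
  have hcmp : Tendsto (fun t => θ t₁ - 1 * (t - t₁)) atTop atBot := by
    have h1 : Tendsto (fun t => -(1 : ℝ) * (t - t₁)) atTop atBot :=
      Tendsto.const_mul_atTop_of_neg (by norm_num) (tendsto_atTop_add_const_right _ _ tendsto_id)
    have h2 := tendsto_atBot_add_const_left atTop (θ t₁) h1
    refine h2.congr fun t => ?_
    ring
  refine tendsto_atBot_mono' atTop ?_ hcmp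
  filter_upwards [eventually_ge_atTop t₁] with t ht
  have := key t ht
  linarith

/-- **Outer strip for every non-diverging motion (upper side).** If the frequency mismatch does NOT
diverge to `+∞`, then `ω(t) + α sin θ(t) ≤ u⁺` at ALL times `t`. -/
theorem windup_le_of_not_tendsto_atTop (hD : 0 < G.D) (hα : 0 ≤ G.α) {θ ω : ℝ → ℝ}
    (h : G.IsSolution θ ω) (hn : ¬ Tendsto ω atTop atTop) (t : ℝ) :
    G.windup (θ t) (ω t) ≤ G.divergeUp := by
  by_contra hlt
  exact hn (tendsto_freq_atTop_of_windup_gt hD hα h (not_le.mp hlt))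

/-- **Outer strip for every non-diverging motion (lower side).** If the frequency mismatch does NOT
diverge to `−∞`, then `−u⁻ ≤ ω(t) + α sin θ(t)` at ALL times `t`. -/
theorem neg_le_windup_of_not_tendsto_atBot (hD : 0 < G.D) (hα : 0 ≤ G.α) {θ ω : ℝ → ℝ}
    (h : G.IsSolution θ ω) (hn : ¬ Tendsto ω atTop atBot) (t : ℝ) :
    -G.divergeDown ≤ G.windup (θ t) (ω t) := by
  by_contra hlt
  exact hn (tendsto_freq_atBot_of_windup_lt hD hα h (not_le.mp hlt))

/-- **The attracting basin of the operating point lies in a certified strip.** For `D > 0`, `α ≥ 0`: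
every solution of Eq. (1) whose frequency mismatch has a finite limit (in particular every motion
attracted by an equilibrium `(θ*, 0)`) satisfies `−u⁻ ≤ ω(t) + α sin θ(t) ≤ u⁺` for EVERY `t ∈ ℝ`
— an OUTER estimate of the basin of the operational state, to be read beside the certified INNER
sublevel piece of the G3.d row (sufficient ≠ necessary: the true basin is sandwiched). -/
theorem windup_mem_Icc_of_tendsto (hD : 0 < G.D) (hα : 0 ≤ G.α) {θ ω : ℝ → ℝ}
    (h : G.IsSolution θ ω) {w : ℝ} (hw : Tendsto ω atTop (𝓝 w)) (t : ℝ) :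
    G.windup (θ t) (ω t) ∈ Icc (-G.divergeDown) G.divergeUp :=
  ⟨neg_le_windup_of_not_tendsto_atBot hD hα h (hw.not_tendsto (disjoint_nhds_atBot w)) t,
    windup_le_of_not_tendsto_atTop hD hα h (hw.not_tendsto (disjoint_nhds_atTop w)) t⟩

/-! ## §2 The instance of record «PLLSWING-Du-I04» (`GenSwing.duI04`) -/

namespace duI04

/-- `u⁺(duI04) = 7/10 + (1 − 63365/158413)/(39/100) = 138294749/61781070 ≈ 2.23847`. -/
theorem divergeUp_eq : duI04.divergeUp = 138294749 / 61781070 := by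
  norm_num [divergeUp, duI04]

/-- `u⁻(duI04) = 7/10 + (1 + 63365/158413)/(39/100) = 265024749/61781070 ≈ 4.28974`. -/
theorem divergeDown_eq : duI04.divergeDown = 265024749 / 61781070 := by
  norm_num [divergeDown, duI04]

/-- **«PLLSWING-Du-I04», divergence to `+∞`.** Every classical solution of the PLL generalized
swing equation at the instance of record with `ω(t₀) + (7/10) sin θ(t₀) ≥ 56/25` at some instant
has `ω(t) → +∞` (`56/25 = 2.24 > u⁺ ≈ 2.2385`). MODELLED: Eq. (1) at printed `(0.4, 0.39, 0.7)`,
`I′ = 63365/158413`; VALIDATED comparator: the simulated basin of `ω = +∞` in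
[cite: DuEtAl2024, Fig. 1(b)]. -/
theorem tendsto_freq_atTop {θ ω : ℝ → ℝ} (h : duI04.IsSolution θ ω) {t₀ : ℝ}
    (h0 : 56 / 25 ≤ ω t₀ + 7 / 10 * sin (θ t₀)) : Tendsto ω atTop atTop := by
  refine tendsto_freq_atTop_of_windup_gt (G := duI04) (by norm_num [duI04]) (by norm_num [duI04]) h
    (t₀ := t₀) ?_
  rw [divergeUp_eq]
  have hu : duI04.windup (θ t₀) (ω t₀) = ω t₀ + 7 / 10 * sin (θ t₀) := by
    norm_num [windup, duI04]
  rw [hu]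
  linarith

/-- **«PLLSWING-Du-I04»**: on the same motions the phase mismatch slips indefinitely,
`θ(t) → +∞`. -/
theorem tendsto_angle_atTop {θ ω : ℝ → ℝ} (h : duI04.IsSolution θ ω) {t₀ : ℝ}
    (h0 : 56 / 25 ≤ ω t₀ + 7 / 10 * sin (θ t₀)) : Tendsto θ atTop atTop :=
  tendsto_angle_atTop_of_tendsto_freq_atTop h (tendsto_freq_atTop h h0)

/-- **«PLLSWING-Du-I04», divergence to `−∞`.** Every classical solution with
`ω(t₀) + (7/10) sin θ(t₀) ≤ −43/10` at some instant has `ω(t) → −∞`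
(`43/10 = 4.3 > u⁻ ≈ 4.2897`). VALIDATED comparator: the simulated basin of `ω = −∞` (ibid.). -/
theorem tendsto_freq_atBot {θ ω : ℝ → ℝ} (h : duI04.IsSolution θ ω) {t₀ : ℝ}
    (h0 : ω t₀ + 7 / 10 * sin (θ t₀) ≤ -(43 / 10)) : Tendsto ω atTop atBot := by
  refine tendsto_freq_atBot_of_windup_lt (G := duI04) (by norm_num [duI04]) (by norm_num [duI04]) h
    (t₀ := t₀) ?_
  rw [divergeDown_eq]
  have hu : duI04.windup (θ t₀) (ω t₀) = ω t₀ + 7 / 10 * sin (θ t₀) := by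
    norm_num [windup, duI04]
  rw [hu]
  linarith

/-- **«PLLSWING-Du-I04»**: on the downward-diverging motions `θ(t) → −∞`. -/
theorem tendsto_angle_atBot {θ ω : ℝ → ℝ} (h : duI04.IsSolution θ ω) {t₀ : ℝ}
    (h0 : ω t₀ + 7 / 10 * sin (θ t₀) ≤ -(43 / 10)) : Tendsto θ atTop atBot :=
  tendsto_angle_atBot_of_tendsto_freq_atBot h (tendsto_freq_atBot h h0)

/-- **«PLLSWING-Du-I04», outer strip for the basin of the operating point.** Every classical
solution whose frequency mismatch converges (to any finite value — e.g. the motions of the certified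
basin `deg4_A_k32_wide_basin`, where `ω → 0`) satisfies, at EVERY time `t`,
`−265024749/61781070 ≤ ω(t) + (7/10) sin θ(t) ≤ 138294749/61781070`, hence the rounded
`−43/10 ≤ ω(t) + (7/10) sin θ(t) ≤ 56/25`: the attracting basin of the operational state of
[cite: DuEtAl2024, Fig. 1(b)] is contained in this strip (OUTER, kernel) and contains the G3.d
sublevel piece (INNER, kernel). -/
theorem windup_strip_of_tendsto {θ ω : ℝ → ℝ} (h : duI04.IsSolution θ ω) {w : ℝ}
    (hw : Tendsto ω atTop (𝓝 w)) (t : ℝ) :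
    -(43 / 10 : ℝ) ≤ ω t + 7 / 10 * sin (θ t) ∧ ω t + 7 / 10 * sin (θ t) ≤ 56 / 25 := by
  have hm := windup_mem_Icc_of_tendsto (G := duI04) (by norm_num [duI04]) (by norm_num [duI04]) h hw t
  rw [divergeUp_eq, divergeDown_eq] at hm
  have hu : duI04.windup (θ t) (ω t) = ω t + 7 / 10 * sin (θ t) := by
    norm_num [windup, duI04]
  rw [hu] at hm
  constructor
  · linarith [hm.1]
  · linarith [hm.2]

end duI04

end Summit.Ventures.GridStability.Models.InverterPLL.GenSwing

end
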